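import Summits.NavierStokesRegularity.NavierStokesRegularity.Theorems.AxisymmetricExtremalityAxisymmetricKatoGlobalStubSeregin2020TypeIILemma22DeGiorgiTools
import Literature.Analysis.FluidPDE.LeiZhang2011Cutoff
import HarnessLib

/-!
# Seregin 2020, Lemma 2.2 (after Nazarov–Uraltseva 2012), atom M1 (`lemma22_moserStep`):
# the cut-offs and the chain rules — `Θ = φ³` for the radial cut-off `φ` (axis term of one sign),
# the time cut-off, and the slices of `v = (l-Φ)₊^{q/2}`, `w = η^{1/2} v φ³`

Helper toward the registered stub `lemma22_moserStep` of stmt-NavierStokesRegularity-15453 (crux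
`AxisymmetricKatoGlobal`; Seregin 2020 Lemma 2.2 ⇐ N–U 2012 Lemma 3.1, one reverse-Hölder step).
The energy class is tested with `H = ((l-τ)₊)^q` (`q > 2`, `DeGiorgiTools.powerTest_energyClass_props`),
the spatial cut-off `Θ = φ³`, `φ = radialCutoff ρ₂ ρ₁` (Lei–Zhang's radially non-increasing
cut-off: `φ ∂_{e_ϱ}φ ≤ 0`, so the axis term `∫∫ η (2/ϱ) H(Φ) ∂_{e_ϱ}(Θ²)` of the class is `≤ 0` and is
dropped — N–U Remark 9 / Lei–Zhang §2), and a `smoothTransition` time cut-off `η`. This file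
records the pointwise calculus:

* `moserTheta_props` — `Θ = φ³`: `C¹`, compact support in `B̄(ρ₁)`, `0 ≤ Θ ≤ 1`, `Θ = 1` on
  `B(ρ₂)`, `‖∇Θ‖ ≤ 3‖Dφ‖`, `|⟪U, ∇Θ²⟩| ≤ 6 φ⁵ |U| ‖Dφ‖`, and the sign of the axis integrand;
* `moserTime_props` — the time cut-off between `t₁` and `s₁ > t₁`;
* `sq_norm_fderiv_posPart_rpow_half_comp_le` — `‖∇(l-Φ)₊^{q/2}‖² ≤ ½ H''(Φ) ‖∇Φ‖²`
  (`2 s'² ≤ H''`, `SignedPowers`);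
* `sq_norm_fderiv_wSlice_le` — `‖∇(η^{1/2} v φ³)‖² ≤ η H''(Φ)‖∇Φ‖² Θ² + 18 η v² ‖Dφ‖²`.

## References

* A. I. Nazarov, N. N. Uraltseva, St. Petersburg Math. J. 23 (2012) 93–115 = arXiv:1011.1888,
  §3, Lemma 3.1, (3.2)–(3.6), Remarks 5, 6, 9. [NazarovUraltseva2012]
* Z. Lei, Q. S. Zhang, J. Funct. Anal. 261 (2011) = arXiv:1011.5066, §2 (2.1) (the cut-offs).
  [LeiZhang2011]
* G. Seregin, Anal. Math. Phys. 10 (2020), Paper 46 = arXiv:2006.04140, Lemma 2.2. [Seregin2020]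
-/

-- the problem directory repeats the summit name (D-0017); core's `dupNamespace` linter fires
set_option linter.dupNamespace false

noncomputable section

open MeasureTheory Set Function Filter Topology Metric
open scoped NNReal ENNReal RealInnerProductSpace

namespace Summit.NavierStokesRegularity.NavierStokesRegularity.Theorems.AxisymmetricKatoGlobal.EulerScaling

open Literature.Analysis.FluidPDE Literature.Analysis.FluidPDE.LeiZhang2011

/-! ### The spatial cut-off `Θ = φ³` -/

/-- `D(φ³) = 3φ² Dφ` for a differentiable scalar function. [folklore] -/
theorem fderiv_pow_three {φ : EuclideanSpace ℝ (Fin 3) → ℝ} (hφ : Differentiable ℝ φ)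
    (y : EuclideanSpace ℝ (Fin 3)) :
    fderiv ℝ (fun z => φ z ^ 3) y = (3 * φ y ^ 2) • fderiv ℝ φ y := by
  have h := (hφ y).hasFDerivAt.pow 3
  rw [h.fderiv]; norm_num

/-- `D(φ⁶) = 6φ⁵ Dφ`, written for `(φ³)²`. [folklore] -/
theorem fderiv_pow_three_sq {φ : EuclideanSpace ℝ (Fin 3) → ℝ} (hφ : Differentiable ℝ φ)
    (y : EuclideanSpace ℝ (Fin 3)) :
    fderiv ℝ (fun z => (φ z ^ 3) ^ 2) y = (6 * φ y ^ 5) • fderiv ℝ φ y := by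
  have e : (fun z => (φ z ^ 3) ^ 2) = fun z => φ z ^ 6 := by funext z; ring
  have h := (hφ y).hasFDerivAt.pow 6
  rw [e, h.fderiv]; norm_num

/-- **The cut-off `Θ = φ³`, `φ = radialCutoff ρ₂ ρ₁`, `0 ≤ ρ₂ < ρ₁`**: `C¹` with compact support
in `B̄(0, ρ₁)`, `0 ≤ φ ≤ 1`, `φ = 1` on `B(0, ρ₂)`; `‖∇Θ‖ ≤ 3‖Dφ‖`; the drift integrand
`|⟪U, ∇(Θ²)⟩| ≤ 6 φ⁵ ‖U‖ ‖Dφ‖`; and the AXIS INTEGRAND HAS A SIGN: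
`(2/ϱ) (h · ∂_{e_ϱ}(Θ²)) ≤ 0` for every `h ≥ 0` (`φ ∂_{e_ϱ} φ ≤ 0`,
`LeiZhang2011.radialCutoff_mul_fderiv_eR_nonpos`). [cite: LeiZhang2011, §2 (2.1) p. 5 (radially non-increasing cut-off)] -/
theorem moserTheta_props {ρ₂ ρ₁ : ℝ} (h₀ : 0 ≤ ρ₂) (h₁ : ρ₂ < ρ₁)
    {φ : EuclideanSpace ℝ (Fin 3) → ℝ} (hφdef : φ = radialCutoff ρ₂ ρ₁) :
    ContDiff ℝ 1 (fun y => φ y ^ 3) ∧ HasCompactSupport (fun y => φ y ^ 3) ∧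
    tsupport (fun y => φ y ^ 3) ⊆ closedBall (0 : EuclideanSpace ℝ (Fin 3)) ρ₁ ∧
    (∀ y, 0 ≤ φ y ∧ φ y ≤ 1) ∧
    (∀ y ∈ ball (0 : EuclideanSpace ℝ (Fin 3)) ρ₂, φ y = 1) ∧
    (∀ y, ‖gradient (fun z => φ z ^ 3) y‖ ≤ 3 * ‖fderiv ℝ φ y‖) ∧
    (∀ (y U : EuclideanSpace ℝ (Fin 3)),
      |inner ℝ U (gradient (fun z => (φ z ^ 3) ^ 2) y)| ≤ 6 * φ y ^ 5 * ‖U‖ * ‖fderiv ℝ φ y‖) ∧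
    (∀ y (h : ℝ), 0 ≤ h →
      2 / cylRadius y * (h * fderiv ℝ (fun z => (φ z ^ 3) ^ 2) y (eR y)) ≤ 0) := by
  subst hφdef
  have hφs : ContDiff ℝ 1 (radialCutoff ρ₂ ρ₁ : EuclideanSpace ℝ (Fin 3) → ℝ) :=
    radialCutoff_contDiff ρ₂ ρ₁
  have hφd : Differentiable ℝ (radialCutoff ρ₂ ρ₁ : EuclideanSpace ℝ (Fin 3) → ℝ) :=
    hφs.differentiable one_ne_zero
  have hφ01 : ∀ y : EuclideanSpace ℝ (Fin 3), 0 ≤ radialCutoff ρ₂ ρ₁ y ∧ radialCutoff ρ₂ ρ₁ y ≤ 1 :=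
    fun y => ⟨radialCutoff_nonneg _ _ _, radialCutoff_le_one _ _ _⟩
  have hφc : HasCompactSupport (radialCutoff ρ₂ ρ₁ : EuclideanSpace ℝ (Fin 3) → ℝ) :=
    hasCompactSupport_radialCutoff h₀ h₁
  have hsupp3 : tsupport (fun y : EuclideanSpace ℝ (Fin 3) => radialCutoff ρ₂ ρ₁ y ^ 3) ⊆
      tsupport (radialCutoff ρ₂ ρ₁ : EuclideanSpace ℝ (Fin 3) → ℝ) :=
    closure_mono fun y hy => by
      simp only [mem_support, ne_eq] at hy ⊢
      intro h; exact hy (by rw [h]; ring)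
  have hc3 : HasCompactSupport (fun y : EuclideanSpace ℝ (Fin 3) => radialCutoff ρ₂ ρ₁ y ^ 3) := by
    have h := hφc.comp_left (g := fun r : ℝ => r ^ 3) (by norm_num)
    exact h
  refine ⟨hφs.pow 3, hc3, hsupp3.trans (tsupport_radialCutoff_subset h₀ h₁), hφ01,
    fun y hy => radialCutoff_eq_one h₀ h₁ (mem_ball_zero_iff.1 hy).le, fun y => ?_,
    fun y U => ?_, fun y h hh => ?_⟩
  · rw [gradient, LinearIsometryEquiv.norm_map, fderiv_pow_three hφd, norm_smul, Real.norm_eq_abs,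
      abs_of_nonneg (by nlinarith [(hφ01 y).1])]
    have : radialCutoff ρ₂ ρ₁ y ^ 2 ≤ 1 := pow_le_one₀ (hφ01 y).1 (hφ01 y).2
    nlinarith [norm_nonneg (fderiv ℝ (radialCutoff ρ₂ ρ₁ : EuclideanSpace ℝ (Fin 3) → ℝ) y)]
  · have e : gradient (fun z : EuclideanSpace ℝ (Fin 3) => (radialCutoff ρ₂ ρ₁ z ^ 3) ^ 2) y =
        (6 * radialCutoff ρ₂ ρ₁ y ^ 5) •
          gradient (radialCutoff ρ₂ ρ₁ : EuclideanSpace ℝ (Fin 3) → ℝ) y := by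
      simp only [gradient, fderiv_pow_three_sq hφd, map_smul]
    rw [e, real_inner_smul_right]
    have hg : ‖gradient (radialCutoff ρ₂ ρ₁ : EuclideanSpace ℝ (Fin 3) → ℝ) y‖ =
        ‖fderiv ℝ (radialCutoff ρ₂ ρ₁ : EuclideanSpace ℝ (Fin 3) → ℝ) y‖ := by
      rw [gradient, LinearIsometryEquiv.norm_map]
    have h5 : 0 ≤ 6 * radialCutoff ρ₂ ρ₁ y ^ 5 := by nlinarith [pow_nonneg (hφ01 y).1 5]
    calc |6 * radialCutoff ρ₂ ρ₁ y ^ 5 *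
            inner ℝ U (gradient (radialCutoff ρ₂ ρ₁ : EuclideanSpace ℝ (Fin 3) → ℝ) y)|
        = 6 * radialCutoff ρ₂ ρ₁ y ^ 5 *
            |inner ℝ U (gradient (radialCutoff ρ₂ ρ₁ : EuclideanSpace ℝ (Fin 3) → ℝ) y)| := by
          rw [abs_mul, abs_of_nonneg h5]
      _ ≤ 6 * radialCutoff ρ₂ ρ₁ y ^ 5 *
            (‖U‖ * ‖gradient (radialCutoff ρ₂ ρ₁ : EuclideanSpace ℝ (Fin 3) → ℝ) y‖) :=
          mul_le_mul_of_nonneg_left (abs_real_inner_le_norm _ _) h5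
      _ = 6 * radialCutoff ρ₂ ρ₁ y ^ 5 * ‖U‖ *
            ‖fderiv ℝ (radialCutoff ρ₂ ρ₁ : EuclideanSpace ℝ (Fin 3) → ℝ) y‖ := by rw [hg]; ring
  · rw [fderiv_pow_three_sq hφd, _root_.smul_apply, smul_eq_mul]
    have hsign := radialCutoff_mul_fderiv_eR_nonpos h₁ h₀ y
    have hr : 0 ≤ 2 / cylRadius y := div_nonneg zero_le_two (cylRadius_nonneg y)
    have hprod : h * (6 * radialCutoff ρ₂ ρ₁ y ^ 5 *
        fderiv ℝ (radialCutoff ρ₂ ρ₁ : EuclideanSpace ℝ (Fin 3) → ℝ) y (eR y)) ≤ 0 := by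
      have e : 6 * radialCutoff ρ₂ ρ₁ y ^ 5 *
          fderiv ℝ (radialCutoff ρ₂ ρ₁ : EuclideanSpace ℝ (Fin 3) → ℝ) y (eR y) =
          6 * radialCutoff ρ₂ ρ₁ y ^ 4 * (radialCutoff ρ₂ ρ₁ y *
            fderiv ℝ (radialCutoff ρ₂ ρ₁ : EuclideanSpace ℝ (Fin 3) → ℝ) y (eR y)) := by ring
      rw [e]
      have h4 : 0 ≤ 6 * radialCutoff ρ₂ ρ₁ y ^ 4 := by nlinarith [pow_nonneg (hφ01 y).1 4]
      exact mul_nonpos_of_nonneg_of_nonpos hh (mul_nonpos_of_nonneg_of_nonpos h4 hsign)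
    exact mul_nonpos_of_nonneg_of_nonpos hr hprod

/-! ### The time cut-off -/

/-- **The time cut-off between `t₁ < s₁`**: `η(s) = smoothTransition((s - t₁)/(s₁ - t₁))` is `C¹`,
`η(t₁) = 0`, `η = 1` on `[s₁, ∞)`, `0 ≤ η ≤ 1`, `|η'| ≤ C_T/(s₁ - t₁)` (`C_T` the absolute bound of
`smoothTransition'`). [cite: LeiZhang2011, §2 (2.1) p. 5 (the time cut-off)] -/
theorem moserTime_props {t₁ s₁ : ℝ} (h : t₁ < s₁) {CT : ℝ}
    (hCT : ∀ t, |deriv Real.smoothTransition t| ≤ CT) {η : ℝ → ℝ}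
    (hηdef : η = fun s => Real.smoothTransition ((s - t₁) / (s₁ - t₁))) :
    ContDiff ℝ 1 η ∧ η t₁ = 0 ∧ (∀ s, s₁ ≤ s → η s = 1) ∧ (∀ s, 0 ≤ η s ∧ η s ≤ 1) ∧
    (∀ s, |deriv η s| ≤ CT / (s₁ - t₁)) := by
  obtain ⟨h1, h2, h3, h4, h5⟩ := timeCutoff_props (T₁ := -t₁) (T₂ := -s₁) (by linarith) hCT
  have e : (fun s : ℝ => Real.smoothTransition ((s + -t₁) / (-t₁ - -s₁))) = η := by
    rw [hηdef]; funext s; congr 1; ring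
  rw [e] at h1 h5
  refine ⟨h1, ?_, fun s hs => ?_, fun s => ?_, fun s => ?_⟩
  · rw [hηdef]; simp [Real.smoothTransition.zero]
  · have := congrFun e s; rw [← this]; exact h3 s (by linarith)
  · have := congrFun e s; rw [← this]; exact h4 s
  · have e' : -t₁ - -s₁ = s₁ - t₁ := by ring
    rw [← e']; exact h5 s

/-! ### The slices of `v = (l - Φ)₊^{q/2}` and of `w = η^{1/2} v φ³` -/

/-- **Chain rule for `v = s(Φ)`, `s(τ) = ((l-τ)₊)^{q/2}`, `q > 2`**: for a `C¹` slice `Φ`,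
`x ↦ ((l - Φ x)₊)^{q/2}` is `C¹` and `‖D((l-Φ)₊^{q/2})(x)‖² ≤ ½ H''(Φ x) ‖∇Φ(x)‖²` with
`H = ((l-·)₊)^q` (`2 s'² ≤ H''`, `SignedPowers.two_mul_deriv_posPart_const_sub_rpow_half_sq_le`).
[cite: NazarovUraltseva2012, proof of Lemma 3.1, (3.2) with φ(τ) = τ₊^p (the term (2p-1)/p · a DvDv)] -/
theorem sq_norm_fderiv_posPart_rpow_half_comp_le {Ψ : EuclideanSpace ℝ (Fin 3) → ℝ}
    (hΨ : ContDiff ℝ 1 Ψ) {q : ℝ} (hq : 2 < q) (l : ℝ) :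
    ContDiff ℝ 1 (fun x => max (l - Ψ x) 0 ^ (q / 2)) ∧
    ∀ x, ‖fderiv ℝ (fun x => max (l - Ψ x) 0 ^ (q / 2)) x‖ ^ 2 ≤
      1 / 2 * deriv (deriv fun τ : ℝ => max (l - τ) 0 ^ q) (Ψ x) * ‖gradient Ψ x‖ ^ 2 := by
  set s : ℝ → ℝ := fun τ => max (l - τ) 0 ^ (q / 2) with hs
  have hs1 : ContDiff ℝ 1 s := contDiff_one_posPart_const_sub_rpow_half hq l
  have hcomp : ContDiff ℝ 1 (fun x => max (l - Ψ x) 0 ^ (q / 2)) := hs1.comp hΨ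
  refine ⟨hcomp, fun x => ?_⟩
  have hΨd : DifferentiableAt ℝ Ψ x := hΨ.differentiable one_ne_zero x
  have hsd : DifferentiableAt ℝ s (Ψ x) := hs1.differentiable one_ne_zero _
  have hchain : fderiv ℝ (fun x => max (l - Ψ x) 0 ^ (q / 2)) x = deriv s (Ψ x) • fderiv ℝ Ψ x := by
    have h := hsd.hasDerivAt.comp_hasFDerivAt x hΨd.hasFDerivAt
    exact h.fderiv
  rw [hchain, norm_smul, Real.norm_eq_abs, mul_pow, sq_abs, gradient, LinearIsometryEquiv.norm_map]
  have key := two_mul_deriv_posPart_const_sub_rpow_half_sq_le hq l (Ψ x)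
  have hn : 0 ≤ ‖fderiv ℝ Ψ x‖ ^ 2 := sq_nonneg _
  nlinarith

/-- **The slice of `w = η^{1/2} v φ³` and its gradient**: for a `C¹` slice `Φ`, `q > 2`,
`0 ≤ c` (`c = η(t)`), `φ ∈ C¹` with `0 ≤ φ ≤ 1`, the function
`x ↦ c^{1/2} ((l - Φ x)₊)^{q/2} φ(x)³` is `C¹` and
`‖D w‖² ≤ c H''(Φ)‖∇Φ‖² (φ³)² + 18 c ((l-Φ)₊)^q ‖Dφ‖²` pointwise
(`(a+b)² ≤ 2a² + 2b²`, `‖Dφ³‖ ≤ 3‖Dφ‖`). [cite: NazarovUraltseva2012, proof of Lemma 3.1, (3.3)–(3.5) (‖vζ‖_𝒱)] -/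
theorem sq_norm_fderiv_wSlice_le {Ψ φ : EuclideanSpace ℝ (Fin 3) → ℝ} (hΨ : ContDiff ℝ 1 Ψ)
    (hφ : ContDiff ℝ 1 φ) (hφ01 : ∀ y, 0 ≤ φ y ∧ φ y ≤ 1) {q : ℝ} (hq : 2 < q) (l : ℝ) {c : ℝ}
    (hc : 0 ≤ c) :
    ContDiff ℝ 1 (fun x => c ^ ((1 : ℝ) / 2) * max (l - Ψ x) 0 ^ (q / 2) * φ x ^ 3) ∧
    ∀ x, ‖fderiv ℝ (fun x => c ^ ((1 : ℝ) / 2) * max (l - Ψ x) 0 ^ (q / 2) * φ x ^ 3) x‖ ^ 2 ≤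
      c * (deriv (deriv fun τ : ℝ => max (l - τ) 0 ^ q) (Ψ x) * ‖gradient Ψ x‖ ^ 2 *
        (φ x ^ 3) ^ 2) + 18 * c * max (l - Ψ x) 0 ^ q * ‖fderiv ℝ φ x‖ ^ 2 := by
  obtain ⟨hv1, hvD⟩ := sq_norm_fderiv_posPart_rpow_half_comp_le hΨ hq l
  set v : EuclideanSpace ℝ (Fin 3) → ℝ := fun x => max (l - Ψ x) 0 ^ (q / 2) with hv
  have hφ3 : ContDiff ℝ 1 (fun x => φ x ^ 3) := hφ.pow 3
  have hφd : Differentiable ℝ φ := hφ.differentiable one_ne_zero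
  have hprod : ContDiff ℝ 1 (fun x => v x * φ x ^ 3) := hv1.mul hφ3
  have hfull : ContDiff ℝ 1 (fun x => c ^ ((1 : ℝ) / 2) * max (l - Ψ x) 0 ^ (q / 2) * φ x ^ 3) := by
    have e : (fun x => c ^ ((1 : ℝ) / 2) * max (l - Ψ x) 0 ^ (q / 2) * φ x ^ 3) =
        fun x => c ^ ((1 : ℝ) / 2) * (v x * φ x ^ 3) := by funext x; simp only [hv]; ring
    rw [e]; exact contDiff_const.mul hprod
  refine ⟨hfull, fun x => ?_⟩
  have hvd : DifferentiableAt ℝ v x := hv1.differentiable one_ne_zero x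
  have hφ3d : DifferentiableAt ℝ (fun x => φ x ^ 3) x := hφ3.differentiable one_ne_zero x
  -- the derivative of the product
  have e1 : (fun x => c ^ ((1 : ℝ) / 2) * max (l - Ψ x) 0 ^ (q / 2) * φ x ^ 3) =
      fun x => c ^ ((1 : ℝ) / 2) * (v x * φ x ^ 3) := by funext y; simp only [hv]; ring
  have hD : fderiv ℝ (fun x => c ^ ((1 : ℝ) / 2) * (v x * φ x ^ 3)) x =
      c ^ ((1 : ℝ) / 2) • (v x • fderiv ℝ (fun x => φ x ^ 3) x + φ x ^ 3 • fderiv ℝ v x) := by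
    exact ((hvd.hasFDerivAt.mul hφ3d.hasFDerivAt).const_mul (c ^ ((1 : ℝ) / 2))).fderiv
  rw [e1, hD, norm_smul, Real.norm_of_nonneg (Real.rpow_nonneg hc _), mul_pow,
    ← Real.rpow_natCast (c ^ ((1 : ℝ) / 2)) 2, ← Real.rpow_mul hc]
  norm_num
  -- `‖a + b‖² ≤ 2‖a‖² + 2‖b‖²`
  have hv0 : 0 ≤ v x := Real.rpow_nonneg (le_max_right _ _) _
  have hφ3le : φ x ^ 3 ≤ 1 := pow_le_one₀ (hφ01 x).1 (hφ01 x).2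
  have hφ30 : 0 ≤ φ x ^ 3 := pow_nonneg (hφ01 x).1 3
  have hA : ‖v x • fderiv ℝ (fun x => φ x ^ 3) x‖ ≤ v x * (3 * ‖fderiv ℝ φ x‖) := by
    rw [norm_smul, Real.norm_of_nonneg hv0, fderiv_pow_three hφd, norm_smul, Real.norm_eq_abs,
      abs_of_nonneg (by nlinarith [(hφ01 x).1])]
    refine mul_le_mul_of_nonneg_left ?_ hv0
    have : φ x ^ 2 ≤ 1 := pow_le_one₀ (hφ01 x).1 (hφ01 x).2
    nlinarith [norm_nonneg (fderiv ℝ φ x)]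
  have hB : ‖φ x ^ 3 • fderiv ℝ v x‖ ≤ φ x ^ 3 * ‖fderiv ℝ v x‖ := by
    rw [norm_smul, Real.norm_of_nonneg hφ30]
  have hsum : ‖v x • fderiv ℝ (fun x => φ x ^ 3) x + φ x ^ 3 • fderiv ℝ v x‖ ≤
      v x * (3 * ‖fderiv ℝ φ x‖) + φ x ^ 3 * ‖fderiv ℝ v x‖ := (norm_add_le _ _).trans (add_le_add hA hB)
  have hsq : ‖v x • fderiv ℝ (fun x => φ x ^ 3) x + φ x ^ 3 • fderiv ℝ v x‖ ^ 2 ≤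
      2 * (v x * (3 * ‖fderiv ℝ φ x‖)) ^ 2 + 2 * (φ x ^ 3 * ‖fderiv ℝ v x‖) ^ 2 := by
    have h0 : 0 ≤ v x * (3 * ‖fderiv ℝ φ x‖) + φ x ^ 3 * ‖fderiv ℝ v x‖ := by positivity
    calc ‖v x • fderiv ℝ (fun x => φ x ^ 3) x + φ x ^ 3 • fderiv ℝ v x‖ ^ 2
        ≤ (v x * (3 * ‖fderiv ℝ φ x‖) + φ x ^ 3 * ‖fderiv ℝ v x‖) ^ 2 :=
          pow_le_pow_left₀ (norm_nonneg _) hsum 2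
      _ ≤ _ := by nlinarith [sq_nonneg (v x * (3 * ‖fderiv ℝ φ x‖) - φ x ^ 3 * ‖fderiv ℝ v x‖)]
  -- `v² = ((l-Ψ)₊)^q` and `‖Dv‖² ≤ ½ H'' ‖∇Ψ‖²`
  have hv2 : v x ^ 2 = max (l - Ψ x) 0 ^ q := posPart_const_sub_rpow_half_sq q l (Ψ x)
  have hDv := hvD x
  have hH'' : 0 ≤ deriv (deriv fun τ : ℝ => max (l - τ) 0 ^ q) (Ψ x) :=
    deriv_deriv_posPart_const_sub_rpow_nonneg hq l (Ψ x)
  have hφ6 : (φ x ^ 3) ^ 2 ≤ 1 := pow_le_one₀ hφ30 hφ3le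
  calc c * ‖v x • fderiv ℝ (fun x => φ x ^ 3) x + φ x ^ 3 • fderiv ℝ v x‖ ^ 2
      ≤ c * (2 * (v x * (3 * ‖fderiv ℝ φ x‖)) ^ 2 + 2 * (φ x ^ 3 * ‖fderiv ℝ v x‖) ^ 2) :=
        mul_le_mul_of_nonneg_left hsq hc
    _ = 18 * c * v x ^ 2 * ‖fderiv ℝ φ x‖ ^ 2 + 2 * c * ((φ x ^ 3) ^ 2 * ‖fderiv ℝ v x‖ ^ 2) := by
        ring
    _ ≤ 18 * c * max (l - Ψ x) 0 ^ q * ‖fderiv ℝ φ x‖ ^ 2 +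
          2 * c * ((φ x ^ 3) ^ 2 * (1 / 2 * deriv (deriv fun τ : ℝ => max (l - τ) 0 ^ q) (Ψ x) *
            ‖gradient Ψ x‖ ^ 2)) := by
        rw [hv2]
        gcongr
    _ = c * (deriv (deriv fun τ : ℝ => max (l - τ) 0 ^ q) (Ψ x) * ‖gradient Ψ x‖ ^ 2 *
          (φ x ^ 3) ^ 2) + 18 * c * max (l - Ψ x) 0 ^ q * ‖fderiv ℝ φ x‖ ^ 2 := by ring

end Summit.NavierStokesRegularity.NavierStokesRegularity.Theorems.AxisymmetricKatoGlobal.EulerScaling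

end
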